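import Summits.QuantumFields.BalabanUV.Beta.GAN24.ExponentialChartJets

/-!
# `BalabanUV.Beta.GAN24.ExponentialChartBackgrounds` — binder row G-an2-4 ∕ (CONV-C), route R7 «TWO CURRENCIES», PART 246: THE JETS OF THE EXPONENTIAL CHART ARE BACKGROUNDS.
# For a REAL Lipschitz background `A` (`(α, β)`, all levels) and every order `j ≤ N`, the jets at `s = 0` of the exponential chart `U_s = exp(isηA)` (PART 245: `∂^j_s(−w)|₀ = −(iA)^j∕n^{j−1}`,
# `∂^j_s z|₀ = −Σ_ν((iA_ν)^j + (−iA_ν)^j)∕n^{j−2}` for `j ≥ 1`, `0` for `j = 0`) are a Lipschitz background `((1+α)^N, (1+α)^N((N+1)β + 2))` resp. a bounded background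
# `(2d(1+α)^N, 4d(1+α)^N(β+1))` — elementary: `‖a^{i+1} − b^{i+1}‖ ≤ (i+1)M^i‖a − b‖`, `n_{k+1} ≥ n_k ≥ 1`; the `j = 1` zeroth-order jet vanishes identically (`θ + (−θ) = 0`) and the `j = 2`
# one is `2Σ_νA_ν²` (consistency `4dαβ`); higher jets carry `n^{−(j−1)}` resp. `n^{−(j−2)}` and are consistent trivially.  PART 247 feeds them to PART 242 (unit b2b-balaban-gan24-p3, gen 65; v1)

NOT IN PRINT; OUR PROOF ([folklore] elementary estimates BY NAME over NE2's `LipschitzBackground` ∕ `BoundedBackground` ∕ `parT`, `one_le_lev'`, `lev_succ'`; nothing printed is a hypothesis).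
HONEST FRAMING (cell contract, verbatim): «discharging `BetaPertH` makes Bałaban's UV stability UNCONDITIONAL — a real constructive-QFT result; it is NOT the
continuum limit and NOT the Clay problem.»  HONEST DEPENDENCY (verbatim): «continuum YM on T⁴ ⇐ BetaPertH ∧ nine spine estimates (0/9 proved); BetaPertH ⇐
(D1) ∧ (D4) ∧ CAP+tail; G-an2-4 gates asym, D1 and NE2/3/4.»

WHAT THIS FILE PROVES (0 sorry, 0 `def`; `q = I·A^{(k)}_ν(x)`, `n_k = L^k`):
* §1 `norm_pow_succ_sub_pow_succ_le` (`‖a^{i+1} − b^{i+1}‖ ≤ (i+1)M^i‖a − b‖`), `natCast_mul_div_pow_succ` (`n(q∕n)^{i+1} = q^{i+1}∕n^i`), `natCast_sq_mul_div_pow` (`n²(q∕n)^{i+2} = q^{i+2}∕n^i`),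
  `cast_lev_le_succ`, `norm_I_mul`, `norm_pow_div_levPow_le` (NE2's `one_le_cast_lev` pattern inlined).
* §2 **`lipschitzBackground_expJetV`**: for `i + 1 ≤ N`, `x ↦ −(iA(x))^{i+1}∕n_k^i` is a `LipschitzBackground ((1+α)^N) ((1+α)^N((N+1)β + 2))`; `lipschitzBackground_zero'`.
* §3 **`boundedBackground_expJetZ`**: for `i + 2 ≤ N`, `x ↦ −Σ_ν((iA_ν(x))^{i+2} + (−iA_ν(x))^{i+2})∕n_k^i` is a `BoundedBackground (2d(1+α)^N) (4d(1+α)^N(β+1))`; `boundedBackground_zero'`.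
WHAT IT DOES NOT DO: the END (PART 247).  SUPPLIER work; NEVER «G-an2-4 closed»; NOT (CONV-C), NOT D1, NOT `BetaPertH`, NOT continuum, NOT Clay.  Records: `HOME/b2b-balaban-gan24-p3/gen65/README.md`.
-/

noncomputable section

open scoped BigOperators ComplexConjugate Matrix Matrix.Norms.L2Operator
open Filter Topology

namespace Summit.QuantumFields.BalabanUV.Beta.GAN24.ExponentialChartBackgrounds

open Literature.MathematicalPhysics.QuantumFieldTheory.Balaban1983to89
open Literature.MathematicalPhysics.QuantumFieldTheory.Balaban1983to89.B5Prop11Plancherel (Tor fine)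
open Literature.MathematicalPhysics.QuantumFieldTheory.Balaban1983to89.B5G183RateUnitTower (lev)
open Summit.QuantumFields.BalabanUV.T4Continuum
open Summit.QuantumFields.BalabanUV.T4Continuum.BalabanAveragedTowerUnit (idx one_le_lev' lev_succ')
open Summit.QuantumFields.BalabanUV.T4Continuum.BlockPairingGeometry (tau parT)
open Summit.QuantumFields.BalabanUV.T4Continuum.FirstOrderBackgroundModel (LipschitzBackground)
open Summit.QuantumFields.BalabanUV.T4Continuum.PerturbationAlgebra (BoundedBackground)

/-! ## §1 Elementary estimates -/

section Elementary

/-- `‖a^{i+1} − b^{i+1}‖ ≤ (i+1)·M^i·‖a − b‖` for `‖a‖, ‖b‖ ≤ M` (`a^{i+2} − b^{i+2} = a(a^{i+1} − b^{i+1}) + (a − b)b^{i+1}`). [folklore] -/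
theorem norm_pow_succ_sub_pow_succ_le {a b : ℂ} {M : ℝ} (ha : ‖a‖ ≤ M) (hb : ‖b‖ ≤ M) (i : ℕ) :
    ‖a ^ (i + 1) - b ^ (i + 1)‖ ≤ (i + 1) * M ^ i * ‖a - b‖ := by
  have hM : 0 ≤ M := (norm_nonneg a).trans ha
  induction i with
  | zero => simp
  | succ i ih =>
    have e : a ^ (i + 1 + 1) - b ^ (i + 1 + 1) = a * (a ^ (i + 1) - b ^ (i + 1)) + (a - b) * b ^ (i + 1) := by ring
    rw [e]
    calc ‖a * (a ^ (i + 1) - b ^ (i + 1)) + (a - b) * b ^ (i + 1)‖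
        ≤ ‖a‖ * ‖a ^ (i + 1) - b ^ (i + 1)‖ + ‖a - b‖ * ‖b‖ ^ (i + 1) := by
          refine (norm_add_le _ _).trans (add_le_add ?_ ?_)
          · rw [norm_mul]
          · rw [norm_mul, norm_pow]
      _ ≤ M * ((i + 1) * M ^ i * ‖a - b‖) + ‖a - b‖ * M ^ (i + 1) :=
          add_le_add (mul_le_mul ha ih (norm_nonneg _) hM) (mul_le_mul_of_nonneg_left (pow_le_pow_left₀ (norm_nonneg _) hb _) (norm_nonneg _))
      _ = ((i + 1 : ℕ) + 1) * M ^ (i + 1) * ‖a - b‖ := by push_cast; ring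

/-- `n·(q∕n)^{i+1} = q^{i+1}∕n^i` (`n ≠ 0`). [folklore] -/
theorem natCast_mul_div_pow_succ {n : ℕ} (hn : n ≠ 0) (q : ℂ) (i : ℕ) : ((n : ℕ) : ℂ) * (q / ((n : ℕ) : ℂ)) ^ (i + 1) = q ^ (i + 1) / ((n : ℕ) : ℂ) ^ i := by
  have hc : ((n : ℕ) : ℂ) ≠ 0 := by exact_mod_cast hn
  rw [div_pow, pow_succ ((n : ℕ) : ℂ) i]
  field_simp

/-- `n²·(q∕n)^{i+2} = q^{i+2}∕n^i` (`n ≠ 0`). [folklore] -/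
theorem natCast_sq_mul_div_pow {n : ℕ} (hn : n ≠ 0) (q : ℂ) (i : ℕ) : ((n : ℕ) : ℂ) ^ 2 * (q / ((n : ℕ) : ℂ)) ^ (i + 2) = q ^ (i + 2) / ((n : ℕ) : ℂ) ^ i := by
  have hc : ((n : ℕ) : ℂ) ≠ 0 := by exact_mod_cast hn
  rw [div_pow, pow_add ((n : ℕ) : ℂ) i 2]
  field_simp

variable (L : ℕ) [NeZero L]

/-- `n_k ≤ n_{k+1} = L·n_k`. [folklore] -/
theorem cast_lev_le_succ (k : ℕ) : ((lev L k : ℕ) : ℝ) ≤ ((lev L (k + 1) : ℕ) : ℝ) := by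
  rw [lev_succ']
  have hL : 1 ≤ L := Nat.pos_of_ne_zero (NeZero.ne L)
  exact_mod_cast Nat.le_mul_of_pos_left (lev L k) hL

omit [NeZero L] in
/-- `‖I·a‖ = ‖a‖`. [folklore] -/
theorem norm_I_mul (a : ℂ) : ‖Complex.I * a‖ = ‖a‖ := by rw [norm_mul, Complex.norm_I, one_mul]

/-- `‖q^{i+1}∕n_k^i‖ ≤ α^{i+1}` for `‖q‖ ≤ α`. [folklore] -/
theorem norm_pow_div_levPow_le {q : ℂ} {α : ℝ} (hq : ‖q‖ ≤ α) (k i : ℕ) :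
    ‖q ^ (i + 1) / ((lev L k : ℕ) : ℂ) ^ i‖ ≤ α ^ (i + 1) := by
  have hc1 := (Nat.one_le_cast.mpr (one_le_lev' L k) : (1 : ℝ) ≤ ((lev L k : ℕ) : ℝ))
  rw [norm_div, norm_pow, norm_pow, Complex.norm_natCast]
  exact (div_le_self (pow_nonneg (norm_nonneg _) _) (one_le_pow₀ hc1)).trans (pow_le_pow_left₀ (norm_nonneg _) hq _)

end Elementary

/-! ## §2 The connection jets `−(iA)^{i+1}∕n^i` are Lipschitz backgrounds -/

section Vjets

variable {d : ℕ} (L : ℕ) [NeZero L] (M : Fin d → ℕ) [hM : ∀ μ, NeZero (M μ)]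

omit [NeZero L] hM in
/-- a pointwise-zero family is a Lipschitz background for any nonnegative constants. [folklore] -/
theorem lipschitzBackground_zero' {α β : ℝ} (hα : 0 ≤ α) (hβ : 0 ≤ β) : LipschitzBackground L M (fun _ _ _ => (0 : ℂ)) α β where
  nonneg := ⟨hα, hβ⟩
  bound := fun k μ i => by simpa using hα
  lipschitz := fun k μ ν i => by simpa using div_nonneg hβ (Nat.cast_nonneg _)
  consistent := fun k μ i => by simpa using div_nonneg hβ (Nat.cast_nonneg _)

omit hM in
/-- **`lipschitzBackground_expJetV`** — for `i + 1 ≤ N` the `(i+1)`-st connection jet of the exponential chart, `x ↦ −(iA^{(k)}_ν(x))^{i+1}∕n_k^i`, is a Lipschitz background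
`((1+α)^N, (1+α)^N((N+1)β + 2))` when `A` (real, complexified) is a Lipschitz background `(α, β)`: size `α^{i+1}`; lattice-Lipschitz `(i+1)α^iβ∕n_k`; two-level consistency `β∕n_k` for
`i = 0` and `2α^{i+1}∕n_k` for `i ≥ 1` (the finer jet carries `n_{k+1}^{−i} ≤ n_k^{−1}`). [folklore] -/
theorem lipschitzBackground_expJetV {A : (k : ℕ) → Fin d → (idx L M k → ℝ)} {α β : ℝ} (hA : LipschitzBackground L M (fun k ν x => (A k ν x : ℂ)) α β)
    {N i : ℕ} (hi : i + 1 ≤ N) :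
    LipschitzBackground L M (fun k ν x => -((Complex.I * (A k ν x : ℂ)) ^ (i + 1) / ((lev L k : ℕ) : ℂ) ^ i)) ((1 + α) ^ N) ((1 + α) ^ N * ((N + 1) * β + 2)) := by
  obtain ⟨hα, hβ⟩ := hA.nonneg
  have h1α : 1 ≤ 1 + α := le_add_of_nonneg_right hα
  have hαN : ∀ j, j ≤ N → α ^ j ≤ (1 + α) ^ N := fun j hj =>
    (pow_le_pow_left₀ hα (le_add_of_nonneg_left zero_le_one) j).trans (pow_le_pow_right₀ h1α hj)
  have hq : ∀ k ν x, ‖Complex.I * (A k ν x : ℂ)‖ ≤ α := fun k ν x => by rw [norm_I_mul]; exact hA.bound k ν x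
  have hpos : 0 ≤ (1 + α) ^ N := pow_nonneg (zero_le_one.trans h1α) N
  have hβ' : 0 ≤ (N + 1) * β + 2 := by positivity
  refine ⟨⟨hpos, mul_nonneg hpos hβ'⟩, fun k μ x => ?_, fun k μ ν x => ?_, fun k μ x => ?_⟩
  · -- size
    rw [norm_neg]
    exact (norm_pow_div_levPow_le L (hq k μ x) k i).trans (hαN (i + 1) hi)
  · -- lattice-Lipschitz at level `k`
    have hlev : (0 : ℝ) < ((lev L k : ℕ) : ℝ) := lt_of_lt_of_le zero_lt_one ((Nat.one_le_cast.mpr (one_le_lev' L k) : (1 : ℝ) ≤ ((lev L k : ℕ) : ℝ)))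
    have hci : (1 : ℝ) ≤ ((lev L k : ℕ) : ℝ) ^ i := one_le_pow₀ ((Nat.one_le_cast.mpr (one_le_lev' L k) : (1 : ℝ) ≤ ((lev L k : ℕ) : ℝ)))
    have e : -((Complex.I * (A k μ (tau (fine (lev L k) M) ν x) : ℂ)) ^ (i + 1) / ((lev L k : ℕ) : ℂ) ^ i) - -((Complex.I * (A k μ x : ℂ)) ^ (i + 1) / ((lev L k : ℕ) : ℂ) ^ i)
        = ((Complex.I * (A k μ x : ℂ)) ^ (i + 1) - (Complex.I * (A k μ (tau (fine (lev L k) M) ν x) : ℂ)) ^ (i + 1)) / ((lev L k : ℕ) : ℂ) ^ i := by ring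
    have hdiff : ‖Complex.I * (A k μ x : ℂ) - Complex.I * (A k μ (tau (fine (lev L k) M) ν x) : ℂ)‖ ≤ β / ((lev L k : ℕ) : ℝ) := by
      rw [← mul_sub, norm_I_mul, norm_sub_rev]; exact hA.lipschitz k μ ν x
    calc _ = ‖(Complex.I * (A k μ x : ℂ)) ^ (i + 1) - (Complex.I * (A k μ (tau (fine (lev L k) M) ν x) : ℂ)) ^ (i + 1)‖ / ((lev L k : ℕ) : ℝ) ^ i := by
          rw [e, norm_div, norm_pow, Complex.norm_natCast]
      _ ≤ ‖(Complex.I * (A k μ x : ℂ)) ^ (i + 1) - (Complex.I * (A k μ (tau (fine (lev L k) M) ν x) : ℂ)) ^ (i + 1)‖ := div_le_self (norm_nonneg _) hci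
      _ ≤ (i + 1) * α ^ i * (β / ((lev L k : ℕ) : ℝ)) :=
          (norm_pow_succ_sub_pow_succ_le (hq k μ x) (hq k μ _) i).trans (mul_le_mul_of_nonneg_left hdiff (by positivity))
      _ ≤ (1 + α) ^ N * ((N + 1) * β + 2) / ((lev L k : ℕ) : ℝ) := by
          rw [← mul_div_assoc, div_le_div_iff_of_pos_right hlev]
          have h1 : ((i : ℝ) + 1) * α ^ i * β ≤ (N + 1) * (1 + α) ^ N * β := by
            have : (i : ℝ) + 1 ≤ N + 1 := by exact_mod_cast Nat.succ_le_succ (by omega : i ≤ N)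
            exact mul_le_mul_of_nonneg_right (mul_le_mul this (hαN i (by omega)) (pow_nonneg hα i) (by positivity)) hβ
          nlinarith [h1, hpos]
  · -- two-level consistency
    have hlev : (0 : ℝ) < ((lev L k : ℕ) : ℝ) := lt_of_lt_of_le zero_lt_one ((Nat.one_le_cast.mpr (one_le_lev' L k) : (1 : ℝ) ≤ ((lev L k : ℕ) : ℝ)))
    rcases i with _ | i
    · -- `i = 0`: the jet is `−iA`
      have e : -((Complex.I * (A (k + 1) μ x : ℂ)) ^ (0 + 1) / ((lev L (k + 1) : ℕ) : ℂ) ^ 0) - -((Complex.I * (A k μ (parT (lev L k) L M x) : ℂ)) ^ (0 + 1) / ((lev L k : ℕ) : ℂ) ^ 0)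
          = -(Complex.I * ((A (k + 1) μ x : ℂ) - (A k μ (parT (lev L k) L M x) : ℂ))) := by ring
      calc _ = ‖(A (k + 1) μ x : ℂ) - (A k μ (parT (lev L k) L M x) : ℂ)‖ := by
            have h := congrArg Norm.norm e
            simp only [norm_neg, norm_I_mul] at h
            exact h
        _ ≤ β / ((lev L k : ℕ) : ℝ) := hA.consistent k μ x
        _ ≤ (1 + α) ^ N * ((N + 1) * β + 2) / ((lev L k : ℕ) : ℝ) := by
            rw [div_le_div_iff_of_pos_right hlev]
            have h1N : (1 : ℝ) ≤ (1 + α) ^ N := one_le_pow₀ h1α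
            nlinarith [h1N, hβ]
    · -- `i ≥ 1`: both jets are `O(α^{i+2}∕n)`
      have hfine : ‖-((Complex.I * (A (k + 1) μ x : ℂ)) ^ (i + 1 + 1) / ((lev L (k + 1) : ℕ) : ℂ) ^ (i + 1))‖ ≤ α ^ (i + 1 + 1) / ((lev L k : ℕ) : ℝ) := by
        rw [norm_neg, norm_div, norm_pow, norm_pow, Complex.norm_natCast, pow_succ ((lev L (k + 1) : ℕ) : ℝ) i, ← div_div]
        have hc1' := (Nat.one_le_cast.mpr (one_le_lev' L (k + 1)) : (1 : ℝ) ≤ ((lev L (k + 1) : ℕ) : ℝ))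
        have hA1 : ‖Complex.I * (A (k + 1) μ x : ℂ)‖ ^ (i + 1 + 1) / ((lev L (k + 1) : ℕ) : ℝ) ^ i ≤ α ^ (i + 1 + 1) :=
          (div_le_self (pow_nonneg (norm_nonneg _) _) (one_le_pow₀ hc1')).trans (pow_le_pow_left₀ (norm_nonneg _) (hq (k + 1) μ x) _)
        exact (div_le_div_of_nonneg_right hA1 (zero_le_one.trans hc1')).trans
          (div_le_div_of_nonneg_left (pow_nonneg hα _) hlev (cast_lev_le_succ L k))
      have hcoarse : ‖-((Complex.I * (A k μ (parT (lev L k) L M x) : ℂ)) ^ (i + 1 + 1) / ((lev L k : ℕ) : ℂ) ^ (i + 1))‖ ≤ α ^ (i + 1 + 1) / ((lev L k : ℕ) : ℝ) := by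
        rw [norm_neg, norm_div, norm_pow, norm_pow, Complex.norm_natCast, pow_succ ((lev L k : ℕ) : ℝ) i, ← div_div]
        have hA1 : ‖Complex.I * (A k μ (parT (lev L k) L M x) : ℂ)‖ ^ (i + 1 + 1) / ((lev L k : ℕ) : ℝ) ^ i ≤ α ^ (i + 1 + 1) :=
          (div_le_self (pow_nonneg (norm_nonneg _) _) (one_le_pow₀ ((Nat.one_le_cast.mpr (one_le_lev' L k) : (1 : ℝ) ≤ ((lev L k : ℕ) : ℝ))))).trans (pow_le_pow_left₀ (norm_nonneg _) (hq k μ _) _)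
        exact div_le_div_of_nonneg_right hA1 hlev.le
      calc _ ≤ α ^ (i + 1 + 1) / ((lev L k : ℕ) : ℝ) + α ^ (i + 1 + 1) / ((lev L k : ℕ) : ℝ) := (norm_sub_le _ _).trans (add_le_add hfine hcoarse)
        _ ≤ (1 + α) ^ N * ((N + 1) * β + 2) / ((lev L k : ℕ) : ℝ) := by
            rw [← add_div, div_le_div_iff_of_pos_right hlev]
            have h2 := hαN (i + 1 + 1) hi
            have h3 : 0 ≤ (1 + α) ^ N * ((N + 1) * β) := mul_nonneg hpos (by positivity)
            nlinarith [h2, h3]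

end Vjets

/-! ## §3 The zeroth-order jets `−Σ_ν((iA_ν)^{i+2} + (−iA_ν)^{i+2})∕n^i` are bounded backgrounds -/

section Zjets

variable {d : ℕ} (L : ℕ) [NeZero L] (M : Fin d → ℕ) [hM : ∀ μ, NeZero (M μ)]

omit [NeZero L] hM in
/-- a pointwise-zero family is a bounded background for any nonnegative constants. [folklore] -/
theorem boundedBackground_zero' {α β : ℝ} (hα : 0 ≤ α) (hβ : 0 ≤ β) : BoundedBackground L M (fun _ _ => (0 : ℂ)) α β where
  nonneg := ⟨hα, hβ⟩
  bound := fun k i => by simpa using hα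
  consistent := fun k i => by simpa using div_nonneg hβ (Nat.cast_nonneg _)

omit hM in
/-- **`boundedBackground_expJetZ`** — for `i + 2 ≤ N` the `(i+2)`-nd zeroth-order jet of the exponential chart, `x ↦ −Σ_ν((iA_ν(x))^{i+2} + (−iA_ν(x))^{i+2})∕n_k^i`, is a bounded background
`(2d(1+α)^N, 4d(1+α)^N(β+1))`: size `2dα^{i+2}`; two-level consistency `2d·2α·β∕n_k` for `i = 0` (the jet `2Σ_νA_ν²`; `‖a² − b²‖ ≤ 2α‖a − b‖`) and `4dα^{i+2}∕n_k` for `i ≥ 1`. [folklore] -/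
theorem boundedBackground_expJetZ {A : (k : ℕ) → Fin d → (idx L M k → ℝ)} {α β : ℝ} (hA : LipschitzBackground L M (fun k ν x => (A k ν x : ℂ)) α β)
    {N i : ℕ} (hi : i + 2 ≤ N) :
    BoundedBackground L M (fun k x => -((∑ ν, ((Complex.I * (A k ν x : ℂ)) ^ (i + 2) + (-(Complex.I * (A k ν x : ℂ))) ^ (i + 2))) / ((lev L k : ℕ) : ℂ) ^ i))
      (2 * (d * (1 + α) ^ N)) (4 * (d * ((1 + α) ^ N * (β + 1)))) := by
  obtain ⟨hα, hβ⟩ := hA.nonneg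
  have h1α : 1 ≤ 1 + α := le_add_of_nonneg_right hα
  have hαN : ∀ j, j ≤ N → α ^ j ≤ (1 + α) ^ N := fun j hj =>
    (pow_le_pow_left₀ hα (le_add_of_nonneg_left zero_le_one) j).trans (pow_le_pow_right₀ h1α hj)
  have hq : ∀ k ν x, ‖Complex.I * (A k ν x : ℂ)‖ ≤ α := fun k ν x => by rw [norm_I_mul]; exact hA.bound k ν x
  have hqn : ∀ k ν x, ‖-(Complex.I * (A k ν x : ℂ))‖ ≤ α := fun k ν x => by rw [norm_neg]; exact hq k ν x
  have hpos : 0 ≤ (1 + α) ^ N := pow_nonneg (zero_le_one.trans h1α) N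
  -- the per-direction size bound at level k with the `n^{-i}` factor kept
  have hterm : ∀ k ν (x : idx L M k), ‖((Complex.I * (A k ν x : ℂ)) ^ (i + 2) + (-(Complex.I * (A k ν x : ℂ))) ^ (i + 2)) / ((lev L k : ℕ) : ℂ) ^ i‖
      ≤ 2 * α ^ (i + 2) / ((lev L k : ℕ) : ℝ) ^ i := by
    intro k ν x
    rw [norm_div, norm_pow, Complex.norm_natCast]
    refine div_le_div_of_nonneg_right ((norm_add_le _ _).trans ?_) (pow_nonneg (Nat.cast_nonneg _) _)
    rw [norm_pow, norm_pow, two_mul]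
    exact add_le_add (pow_le_pow_left₀ (norm_nonneg _) (hq k ν x) _) (pow_le_pow_left₀ (norm_nonneg _) (hqn k ν x) _)
  refine ⟨⟨by positivity, by positivity⟩, fun k x => ?_, fun k x => ?_⟩
  · -- size
    have hci : (1 : ℝ) ≤ ((lev L k : ℕ) : ℝ) ^ i := one_le_pow₀ ((Nat.one_le_cast.mpr (one_le_lev' L k) : (1 : ℝ) ≤ ((lev L k : ℕ) : ℝ)))
    rw [norm_neg, Finset.sum_div]
    calc _ ≤ ∑ _ν : Fin d, 2 * α ^ (i + 2) / ((lev L k : ℕ) : ℝ) ^ i := (norm_sum_le _ _).trans (Finset.sum_le_sum fun ν _ => hterm k ν x)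
      _ = d * (2 * α ^ (i + 2) / ((lev L k : ℕ) : ℝ) ^ i) := by rw [Finset.sum_const, Finset.card_univ, Fintype.card_fin, nsmul_eq_mul]
      _ ≤ d * (2 * α ^ (i + 2)) := mul_le_mul_of_nonneg_left (div_le_self (by positivity) hci) (Nat.cast_nonneg _)
      _ ≤ 2 * (d * (1 + α) ^ N) := by nlinarith [hαN (i + 2) hi, Nat.cast_nonneg (α := ℝ) d]
  · -- two-level consistency
    have hlev : (0 : ℝ) < ((lev L k : ℕ) : ℝ) := lt_of_lt_of_le zero_lt_one ((Nat.one_le_cast.mpr (one_le_lev' L k) : (1 : ℝ) ≤ ((lev L k : ℕ) : ℝ)))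
    rcases i with _ | i
    · -- `i = 0`: the jet is `2Σ_ν A_ν²`; `‖a² − b²‖ ≤ 2α‖a − b‖`
      have hd2 : ∀ ν, ‖(((Complex.I * (A k ν (parT (lev L k) L M x) : ℂ)) ^ (0 + 2) + (-(Complex.I * (A k ν (parT (lev L k) L M x) : ℂ))) ^ (0 + 2))
            - ((Complex.I * (A (k + 1) ν x : ℂ)) ^ (0 + 2) + (-(Complex.I * (A (k + 1) ν x : ℂ))) ^ (0 + 2)))‖
          ≤ 2 * (2 * α * (β / ((lev L k : ℕ) : ℝ))) := by
        intro ν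
        have e : (((Complex.I * (A k ν (parT (lev L k) L M x) : ℂ)) ^ (0 + 2) + (-(Complex.I * (A k ν (parT (lev L k) L M x) : ℂ))) ^ (0 + 2))
            - ((Complex.I * (A (k + 1) ν x : ℂ)) ^ (0 + 2) + (-(Complex.I * (A (k + 1) ν x : ℂ))) ^ (0 + 2)))
            = 2 * ((Complex.I * (A k ν (parT (lev L k) L M x) : ℂ)) ^ (1 + 1) - (Complex.I * (A (k + 1) ν x : ℂ)) ^ (1 + 1)) := by ring
        have hdiff0 : ‖Complex.I * (A (k + 1) ν x : ℂ) - Complex.I * (A k ν (parT (lev L k) L M x) : ℂ)‖ ≤ β / ((lev L k : ℕ) : ℝ) := by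
          have h := hA.consistent k ν x
          have en : ‖Complex.I * (A (k + 1) ν x : ℂ) - Complex.I * (A k ν (parT (lev L k) L M x) : ℂ)‖ = ‖(A (k + 1) ν x : ℂ) - (A k ν (parT (lev L k) L M x) : ℂ)‖ := by
            have e2 : Complex.I * (A (k + 1) ν x : ℂ) - Complex.I * (A k ν (parT (lev L k) L M x) : ℂ) = Complex.I * ((A (k + 1) ν x : ℂ) - (A k ν (parT (lev L k) L M x) : ℂ)) := by ring
            exact (congrArg Norm.norm e2).trans (norm_I_mul _)
          exact en.trans_le h
        have hdiff : ‖Complex.I * (A k ν (parT (lev L k) L M x) : ℂ) - Complex.I * (A (k + 1) ν x : ℂ)‖ ≤ β / ((lev L k : ℕ) : ℝ) :=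
          (norm_sub_rev _ _).trans_le hdiff0
        have hp : ‖(Complex.I * (A k ν (parT (lev L k) L M x) : ℂ)) ^ (1 + 1) - (Complex.I * (A (k + 1) ν x : ℂ)) ^ (1 + 1)‖
            ≤ 2 * α * ‖Complex.I * (A k ν (parT (lev L k) L M x) : ℂ) - Complex.I * (A (k + 1) ν x : ℂ)‖ := by
          have h := norm_pow_succ_sub_pow_succ_le (hq k ν (parT (lev L k) L M x)) (hq (k + 1) ν x) 1
          norm_num at h
          exact h
        calc _ = 2 * ‖(Complex.I * (A k ν (parT (lev L k) L M x) : ℂ)) ^ (1 + 1) - (Complex.I * (A (k + 1) ν x : ℂ)) ^ (1 + 1)‖ := by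
              have h := congrArg Norm.norm e; rw [norm_mul, Complex.norm_two] at h; exact h
          _ ≤ 2 * (2 * α * (β / ((lev L k : ℕ) : ℝ))) :=
              mul_le_mul_of_nonneg_left (hp.trans (mul_le_mul_of_nonneg_left hdiff (by positivity))) zero_le_two
      have e0 : ∀ (y : ℂ), y / ((lev L (k + 1) : ℕ) : ℂ) ^ 0 = y := fun y => by rw [pow_zero, div_one]
      have e0' : ∀ (y : ℂ), y / ((lev L k : ℕ) : ℂ) ^ 0 = y := fun y => by rw [pow_zero, div_one]
      simp only [e0, e0', neg_sub_neg, ← Finset.sum_sub_distrib]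
      calc _ ≤ ∑ _ν : Fin d, 2 * (2 * α * (β / ((lev L k : ℕ) : ℝ))) := (norm_sum_le _ _).trans (Finset.sum_le_sum fun ν _ => hd2 ν)
        _ = 4 * (d * (α * β)) / ((lev L k : ℕ) : ℝ) := by rw [Finset.sum_const, Finset.card_univ, Fintype.card_fin, nsmul_eq_mul]; ring
        _ ≤ 4 * (d * ((1 + α) ^ N * (β + 1))) / ((lev L k : ℕ) : ℝ) := by
            rw [div_le_div_iff_of_pos_right hlev]
            have h1 : α * β ≤ (1 + α) ^ N * (β + 1) := by nlinarith [hαN 1 (by omega), hpos, pow_one α]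
            nlinarith [h1, Nat.cast_nonneg (α := ℝ) d]
    · -- `i ≥ 1`: both jets are `O(α^{i+3}∕n)`
      have hfine : ‖-((∑ ν, ((Complex.I * (A (k + 1) ν x : ℂ)) ^ (i + 1 + 2) + (-(Complex.I * (A (k + 1) ν x : ℂ))) ^ (i + 1 + 2))) / ((lev L (k + 1) : ℕ) : ℂ) ^ (i + 1))‖
          ≤ d * (2 * α ^ (i + 1 + 2)) / ((lev L k : ℕ) : ℝ) := by
        rw [norm_neg, Finset.sum_div]
        refine (norm_sum_le _ _).trans ((Finset.sum_le_sum fun ν _ => hterm (k + 1) ν x).trans ?_)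
        rw [Finset.sum_const, Finset.card_univ, Fintype.card_fin, nsmul_eq_mul, ← mul_div_assoc]
        rw [pow_succ ((lev L (k + 1) : ℕ) : ℝ) i, ← div_div]
        exact (div_le_div_of_nonneg_right (div_le_self (by positivity) (one_le_pow₀ ((Nat.one_le_cast.mpr (one_le_lev' L (k + 1)) : (1 : ℝ) ≤ ((lev L (k + 1) : ℕ) : ℝ))))) (zero_le_one.trans ((Nat.one_le_cast.mpr (one_le_lev' L (k + 1)) : (1 : ℝ) ≤ ((lev L (k + 1) : ℕ) : ℝ))))).trans
          (div_le_div_of_nonneg_left (by positivity) hlev (cast_lev_le_succ L k))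
      have hcoarse : ‖-((∑ ν, ((Complex.I * (A k ν (parT (lev L k) L M x) : ℂ)) ^ (i + 1 + 2) + (-(Complex.I * (A k ν (parT (lev L k) L M x) : ℂ))) ^ (i + 1 + 2))) / ((lev L k : ℕ) : ℂ) ^ (i + 1))‖
          ≤ d * (2 * α ^ (i + 1 + 2)) / ((lev L k : ℕ) : ℝ) := by
        rw [norm_neg, Finset.sum_div]
        refine (norm_sum_le _ _).trans ((Finset.sum_le_sum fun ν _ => hterm k ν _).trans ?_)
        rw [Finset.sum_const, Finset.card_univ, Fintype.card_fin, nsmul_eq_mul, ← mul_div_assoc]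
        rw [pow_succ ((lev L k : ℕ) : ℝ) i, ← div_div]
        exact div_le_div_of_nonneg_right (div_le_self (by positivity) (one_le_pow₀ ((Nat.one_le_cast.mpr (one_le_lev' L k) : (1 : ℝ) ≤ ((lev L k : ℕ) : ℝ))))) hlev.le
      calc _ ≤ d * (2 * α ^ (i + 1 + 2)) / ((lev L k : ℕ) : ℝ) + d * (2 * α ^ (i + 1 + 2)) / ((lev L k : ℕ) : ℝ) := (norm_sub_le _ _).trans (add_le_add hfine hcoarse)
        _ ≤ 4 * (d * ((1 + α) ^ N * (β + 1))) / ((lev L k : ℕ) : ℝ) := by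
            rw [← add_div, div_le_div_iff_of_pos_right hlev]
            have h2 := hαN (i + 1 + 2) hi
            nlinarith [h2, hpos, hβ, Nat.cast_nonneg (α := ℝ) d, mul_nonneg (Nat.cast_nonneg (α := ℝ) d) hpos, mul_nonneg (Nat.cast_nonneg (α := ℝ) d) hβ]

end Zjets

end Summit.QuantumFields.BalabanUV.Beta.GAN24.ExponentialChartBackgrounds

end
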